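import Literature.Geometry.Lorentzian.MetricNormSq
import HarnessLib

/-!
# Cauchy–Schwarz for the metric square norm: `T(v, w)² ≤ |T|²_g g(v,v) g(w,w)`

Companion of `MetricNormSq.lean` (all results proved). For a **Riemannian** metric `g` on a vector
bundle with finite-dimensional fibres, the metric square norm `|T|²_g = T_{ij} T^{ij}` of a
bilinear form `T` on a fibre (`PseudoRiemannianMetric.normSq`) controls the form pointwise:

* `bilin_apply_eq_sum_repr`, `quad_eq_sum_sq_repr` — expansion of a bilinear form in a basis and
  of a quadratic form in an orthogonal basis;
* `sq_bilin_apply_le` — Cauchy–Schwarz for `T(v,w) = ∑ᵢⱼ (vⁱ√qᵢ · wʲ√qⱼ)(Tᵢⱼ/√(qᵢqⱼ))` in a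
  positive `q`-orthogonal frame (Mathlib's `Finset.sum_mul_sq_le_sq_mul_sq`);
* `PseudoRiemannianMetric.sq_apply_le_normSq_mul` — `T(v, w)² ≤ |T|²_g · g(v,v) · g(w,w)`;
* `PseudoRiemannianMetric.abs_apply_le_sqrt_normSq_mul` — `|T(v, v)| ≤ √|T|²_g · g(v, v)`.

Used for the Ricci variation of Schoen–Yau (Comm. Math. Phys. 65 (1979), p. 72: the metrics
`ds² + t Ric` "are defined in a neighborhood of `t = 0`"): `|Ric(v,v)| ≤ √‖Ric‖² h(v,v)` with
`‖Ric‖²` bounded makes `h + t Ric` positive definite for small `|t|`.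

## References

* B. O'Neill, *Semi-Riemannian geometry with applications to relativity*, Academic Press 1983,
  Ch. 3, pp. 60–61 (metric contraction in a frame).
-/

noncomputable section

open Manifold Bundle Module Finset
open scoped ContDiff

namespace Literature.Geometry.Lorentzian

/-! ### Linear algebra in an orthogonal basis -/

section Algebra

variable {V : Type*} [AddCommGroup V] [Module ℝ V] {ι : Type*} [Fintype ι]

/-- **Bilinear expansion in a basis**: `T(v, w) = ∑ᵢⱼ vⁱ wʲ T(bᵢ, bⱼ)` with `vⁱ = b.repr v i`.
[folklore] -/
theorem bilin_apply_eq_sum_repr (b : Basis ι ℝ V) (T : LinearMap.BilinForm ℝ V) (v w : V) :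
    T v w = ∑ i, ∑ j, b.repr v i * b.repr w j * T (b i) (b j) := by
  conv_lhs => rw [← b.sum_repr v, ← b.sum_repr w]
  simp only [map_sum, map_smul, LinearMap.sum_apply, LinearMap.smul_apply, smul_eq_mul,
    Finset.mul_sum]
  rw [Finset.sum_comm]
  exact Finset.sum_congr rfl fun i _ ↦ Finset.sum_congr rfl fun j _ ↦ by ring

/-- **A quadratic form in an orthogonal basis**: `q(v, v) = ∑ᵢ (vⁱ)² q(bᵢ, bᵢ)` for a
`q`-orthogonal basis `b`. [folklore] -/
theorem quad_eq_sum_sq_repr (b : Basis ι ℝ V) {q : LinearMap.BilinForm ℝ V} (hb : q.IsOrthoᵢ b)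
    (v : V) : q v v = ∑ i, b.repr v i ^ 2 * q (b i) (b i) := by
  rw [bilin_apply_eq_sum_repr b q v v]
  refine Finset.sum_congr rfl fun i _ ↦ ?_
  rw [Finset.sum_eq_single i]
  · ring
  · intro j _ hji
    have h0 : q (b i) (b j) = 0 := hb (Ne.symm hji)
    rw [h0, mul_zero]
  · intro hi
    exact absurd (Finset.mem_univ i) hi

/-- **Cauchy–Schwarz for a bilinear form against a positive orthogonal frame**: if `b` is a
`q`-orthogonal basis with `q(bᵢ, bᵢ) > 0`, then for every bilinear form `T`,
`T(v, w)² ≤ (∑ᵢⱼ T(bᵢ, bⱼ)² / (q(bᵢ,bᵢ) q(bⱼ,bⱼ))) · q(v,v) · q(w,w)` (Cauchy–Schwarz for the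
finite sum `T(v,w) = ∑ᵢⱼ (vⁱ√qᵢ wʲ√qⱼ)(Tᵢⱼ/√(qᵢqⱼ))`, Mathlib's `Finset.sum_mul_sq_le_sq_mul_sq`).
[folklore] -/
theorem sq_bilin_apply_le (b : Basis ι ℝ V) {q : LinearMap.BilinForm ℝ V} (hb : q.IsOrthoᵢ b)
    (hc : ∀ i, 0 < q (b i) (b i)) (T : LinearMap.BilinForm ℝ V) (v w : V) :
    (T v w) ^ 2 ≤ (∑ i, ∑ j, T (b i) (b j) ^ 2 / (q (b i) (b i) * q (b j) (b j))) *
      q v v * q w w := by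
  set c : ι → ℝ := fun i ↦ q (b i) (b i) with hcdef
  have hs : ∀ i, 0 < Real.sqrt (c i) := fun i ↦ Real.sqrt_pos.2 (hc i)
  have hs2 : ∀ i, Real.sqrt (c i) ^ 2 = c i := fun i ↦ Real.sq_sqrt (hc i).le
  have hsne : ∀ i, Real.sqrt (c i) ≠ 0 := fun i ↦ (hs i).ne'
  set a := b.repr v with ha
  set a' := b.repr w with ha'
  set f : ι × ι → ℝ := fun p ↦ a p.1 * Real.sqrt (c p.1) * (a' p.2 * Real.sqrt (c p.2)) with hf
  set g : ι × ι → ℝ := fun p ↦ T (b p.1) (b p.2) / (Real.sqrt (c p.1) * Real.sqrt (c p.2)) with hg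
  have hT : T v w = ∑ p : ι × ι, f p * g p := by
    rw [bilin_apply_eq_sum_repr b T v w, Fintype.sum_prod_type]
    refine Finset.sum_congr rfl fun i _ ↦ Finset.sum_congr rfl fun j _ ↦ ?_
    have h1 := hsne i
    have h2 := hsne j
    simp only [hf, hg]
    field_simp
    rw [ha, ha']
    ring
  have hf2 : ∑ p : ι × ι, f p ^ 2 = q v v * q w w := by
    rw [quad_eq_sum_sq_repr b hb v, quad_eq_sum_sq_repr b hb w, Finset.sum_mul_sum,
      Fintype.sum_prod_type]
    refine Finset.sum_congr rfl fun i _ ↦ Finset.sum_congr rfl fun j _ ↦ ?_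
    simp only [hf]
    rw [show (a i * Real.sqrt (c i) * (a' j * Real.sqrt (c j))) ^ 2 =
      a i ^ 2 * Real.sqrt (c i) ^ 2 * (a' j ^ 2 * Real.sqrt (c j) ^ 2) by ring, hs2, hs2]
  have hg2 : ∑ p : ι × ι, g p ^ 2 = ∑ i, ∑ j, T (b i) (b j) ^ 2 / (c i * c j) := by
    rw [Fintype.sum_prod_type]
    refine Finset.sum_congr rfl fun i _ ↦ Finset.sum_congr rfl fun j _ ↦ ?_
    simp only [hg]
    rw [div_pow, mul_pow, hs2, hs2]
  rw [hT]
  calc (∑ p : ι × ι, f p * g p) ^ 2 ≤ (∑ p : ι × ι, f p ^ 2) * ∑ p : ι × ι, g p ^ 2 :=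
        Finset.sum_mul_sq_le_sq_mul_sq _ f g
    _ = (∑ i, ∑ j, T (b i) (b j) ^ 2 / (q (b i) (b i) * q (b j) (b j))) * q v v * q w w := by
        rw [hf2, hg2]
        ring

end Algebra

/-! ### The metric square norm bounds the form -/

namespace PseudoRiemannianMetric

variable
  {EB : Type*} [NormedAddCommGroup EB] [NormedSpace ℝ EB]
  {HB : Type*} [TopologicalSpace HB] {IB : ModelWithCorners ℝ EB HB} {n : ℕ∞ω}
  {B : Type*} [TopologicalSpace B] [ChartedSpace HB B]
  {F : Type*} [NormedAddCommGroup F] [NormedSpace ℝ F] [FiniteDimensional ℝ F]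
  {E : B → Type*} [TopologicalSpace (TotalSpace F E)]
  [∀ b, TopologicalSpace (E b)] [∀ b, AddCommGroup (E b)] [∀ b, Module ℝ (E b)]
  [FiberBundle F E] [VectorBundle ℝ F E]
  (g : PseudoRiemannianMetric IB n F E) (b : B)

/-- **Cauchy–Schwarz for the metric square norm**: for a Riemannian metric `g`, a bilinear form `T`
on a fibre and vectors `v, w`, `T(v, w)² ≤ |T|²_g · g(v,v) · g(w,w)` (in a `g`-orthogonal frame,
`|T|²_g = ∑ Tᵢⱼ²/(gᵢ gⱼ)` by `normSq_eq_sum_sq`, and `sq_bilin_apply_le`). O'Neill 1983, Ch. 3,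
pp. 60–61 (the contraction `T_{ij}T^{ij}` in a frame). [folklore] -/
theorem sq_apply_le_normSq_mul (hg : g.IsRiemannian) (T : LinearMap.BilinForm ℝ (E b))
    (v w : E b) : (T v w) ^ 2 ≤ g.normSq b T * g.val b v v * g.val b w w := by
  classical
  obtain ⟨e, he, -⟩ := g.exists_isOrthoᵢ_basis b
  have hpos : ∀ i, 0 < g.val b (e i) (e i) := fun i ↦ hg b (e i) (e.ne_zero i)
  rw [g.normSq_eq_sum_sq b e he (fun i ↦ (hpos i).ne') T]
  have hswap : ∑ i, ∑ j, T (e j) (e i) ^ 2 / (g.val b (e i) (e i) * g.val b (e j) (e j)) =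
      ∑ i, ∑ j, T (e i) (e j) ^ 2 / (g.val b (e i) (e i) * g.val b (e j) (e j)) := by
    rw [Finset.sum_comm]
    exact Finset.sum_congr rfl fun i _ ↦ Finset.sum_congr rfl fun j _ ↦ by rw [mul_comm]
  rw [hswap]
  exact sq_bilin_apply_le e he hpos T v w

/-- `|T(v, v)| ≤ √|T|²_g · g(v, v)` for a Riemannian metric. [folklore] -/
theorem abs_apply_le_sqrt_normSq_mul (hg : g.IsRiemannian) (T : LinearMap.BilinForm ℝ (E b))
    (v : E b) : |T v v| ≤ Real.sqrt (g.normSq b T) * g.val b v v := by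
  have h0 : 0 ≤ g.val b v v := by
    by_cases hv : v = 0
    · simp [hv]
    · exact (hg b v hv).le
  have h := g.sq_apply_le_normSq_mul b hg T v v
  calc |T v v| ≤ Real.sqrt (g.normSq b T * g.val b v v * g.val b v v) := Real.abs_le_sqrt h
    _ = Real.sqrt (g.normSq b T) * g.val b v v := by
        rw [mul_assoc, Real.sqrt_mul (g.normSq_nonneg b hg T), Real.sqrt_mul_self h0]

end PseudoRiemannianMetric

end Literature.Geometry.Lorentzian

end
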